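import Summits.BirchSwinnertonDyer.Rank1Residual.Additive.StrictSelmerIndex
import HarnessLib

/-!
# The strict Selmer index in rank one WITH local `p`-torsion allowed:
# `#Sel_str(E/K)[p^∞] = p^ñ · #Ш(E/K)[p^∞]`, `ñ` = the `p`-divisibility level of the generator in
# `E(E)` MODULO TORSION (cell `bsd-print-cfram`, D-0131 (2), typer `ty2` gen 3; PLAN v5 ask (δ)(ii)
# «TORSION-MODDED INDEX THEOREM — twin of `StrictSha.strictSelmerIndexAt_holds`»; regime T of route
# `PrintCFram`, item stmt-BirchSwinnertonDyer-20699, where `W(ℚ₃)[3] ≠ 0`)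

HONEST FRAMING (cell `bsd-print-cfram`, HOME `run/shared/lean/pub/bsd-print-cfram/`): THEOREMS ONLY
(no definition, no named fact, no axiom, no `sorry`); elementary algebra + Galois-cohomology
bookkeeping over the tree's `p^∞` Kummer theory, generic in the prime `p` and the number field;
nothing about BSD; beyond-print theorem: NO.

WHY. Cell b2b-bsdres's `Additive.StrictSha.card_strictSelmer_eq_pow_mul_card_sha_of_hom` /
`strictSelmerIndexAt_holds` (`#Sel_str = pⁿ · #Ш[p^∞]`, `n` the PURE `p`-divisibility level of the
generator `P` in `E(ℚ_p)`) assumes `E(ℚ_p)[p] = 0` (`hnoTors`). On regime T of the `@3` crux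
(`W(ℚ₃)[3] ≠ 0` or `W'(ℚ₃)[3] ≠ 0`) that hypothesis fails. The strict Kummer condition at `E` reads
«`loc(a P) ∈ p^N E(E) + E(E)_tors`» (`E(E) ⊗ ℚ_p/ℤ_p` kills the finite torsion), so the right
exponent is the level MODULO TORSION
  `ñ`: `(∃ Q T, T torsion ∧ p^ñ • Q = loc P + T) ∧ (∀ Q T, T torsion → p^(ñ+1) • Q ≠ loc P + T)`
(`ñ ≥ n`, `=` when `E(E)[p] = 0`). This file proves the index theorem in that form, with NO
torsion hypothesis, by the same snake `Sel_str ↠ Ш[p^∞]` (Greenberg LNM 1716 §2) and two new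
elementary lemmas:
* §1 `kummerMapLevel_mem_selmerLocalKerPrimaryTorsion_of_add_torsion_eq_nsmul` — `κ_N(P)` is strict at
  `E` as soon as `loc P + T = p^N • R` for SOME torsion `T ∈ E(E)` (split `T = T₁ + p^N T₂` with `T₁`
  of `p`-power order — Bezout — then the cocycle is the coboundary of `ιQ − ι_E(R − T₂) ∈ E(Ē)[p^∞]`);
* §2 `le_add_padicValInt_of_zsmul_eq_nsmul_add_modTorsion` — exact mod-torsion level `ñ` and
  `k • loc P = p^N • R + T` (`T` torsion, `k ≠ 0`) force `N ≤ ñ + v_p(k)` (apply a `λ : E(E) → ℤ_p`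
  with kernel the torsion; Bezout `a p + b k₁ = 1`; NO `p`-torsion hypothesis); and
  `exists_modTorsion_level` (exact mod-torsion levels exist for non-torsion points);
* §3 `card_strictSelmer_eq_pow_mul_card_sha_modTorsion` — the general count over a number field `K`
  / perfect `K`-field `E` with `λ` (kernel = torsion, `p^b ℤ_p ⊆ im λ`) and the transport `hloc`;
* over `ℚ` / `ℚ_[p]` (sequel `StrictSelmerIndexModTorsionRat.lean`, ≤ 400-line rule):
  `card_strictSelmerPInfty_eq_pow_mul_card_sha_modTorsion`, its `padicValNat` form, and
  `exists_generator_with_modTorsion_level`.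

References: [GreenbergLNM1716] §2 (pp. 62–63: `E(F) ⊗ ℚ_p/ℤ_p ↪ H¹(F, E[p^∞])`, the local Kummer
map); [KuriharaPollack2007] §1.5 (p. 361: the index of the generator in the fine/strict Selmer group);
[SilvermanAEC2009] Prop. VII.6.3 (`E(ℚ_p) ⊇` finite-index `ℤ_p`), VIII.§1–2; tree: `Additive/StrictSelmerIndex{,Local}.lean`
(p-generic originals, cell b2b-bsdres), `Additive/StrictSelmerDominatesSha(Algebra).lean`.
-/

universe u

noncomputable section

open scoped Classical

open WeierstrassCurve Literature.NumberTheory.EllipticCurves Literature.NumberTheory.GaloisRepresentations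
  Summit.BirchSwinnertonDyer.Rank1Residual.Additive
  Summit.BirchSwinnertonDyer.Rank1Residual.Additive.StrictSha

namespace Summit.BirchSwinnertonDyer.Rank1Residual.X12.O11

/-! ### §1 Local triviality of `κ_N(P)` when `loc P ∈ p^N E(E) + E(E)_tors` -/

/-- **A Kummer class whose local image is `p^N`-divisible MODULO TORSION is locally trivial.** Let
`K` be a field, `E/K` elliptic (`W`), `p` prime, `E ⊇ K` a `K`-field, `P ∈ E(K)`, and
`R, T ∈ E(E)` with `T` torsion and `loc P + T = p^N • R`. Then `κ_N(P) ∈ selmerLocalKerPrimaryTorsion W E p`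
(it dies in `H¹(E, E(Ē)[p^∞])`). Split `T = T₁ + p^N • T₂` with `p^b • T₁ = 0` (Bezout,
`exists_eq_add_nsmul_of_isOfFinAddOrder`); with `R' = R − T₂`, `loc P + T₁ = p^N • R'` and on `Γ_E`
the Kummer cocycle `σ ↦ σQ − Q` (`p^N Q = P`) is the coboundary of `z = ιQ − ι_E R'`, which is
`p^(b+N)`-torsion. The torsion-free case (`T = 0`) is b2b's
`kummerMapLevel_mem_selmerLocalKerPrimaryTorsion_of_eq_nsmul`.
[cite: GreenbergLNM1716, §2 (pp. 62–63: the local Kummer map kills `E(F)_tors ⊗ ℚ_p/ℤ_p = 0`)] -/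
theorem kummerMapLevel_mem_selmerLocalKerPrimaryTorsion_of_add_torsion_eq_nsmul {K : Type u} [Field K]
    (W : WeierstrassCurve K) [W.IsElliptic] (p : ℕ) [Fact p.Prime]
    (hdiv : W.zsmul_geomPoints_surjective) (E : Type u) [Field E] [Algebra K E]
    (N : ℕ) (P : W.toAffine.Point) (R T : (W.baseChange E).toAffine.Point) (hT : IsOfFinAddOrder T)
    (h : Affine.Point.baseChange (W' := W) K E P + T = p ^ N • R) :
    kummerMapLevel W p hdiv N P ∈ selmerLocalKerPrimaryTorsion W E p := by
  -- reduce to `p`-power torsion: `T = T₁ + p^N • T₂`, `p^b • T₁ = 0`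
  obtain ⟨T₁, T₂, b, hT₁, hTeq⟩ := exists_eq_add_nsmul_of_isOfFinAddOrder p hT N
  set R' := R - T₂ with hR'
  have h1 : Affine.Point.baseChange (W' := W) K E P + T₁ = p ^ N • R' := by
    rw [hR', smul_sub, ← h, hTeq]; abel
  have hQn := nsmul_kummerRoot W p hdiv N P
  set Q := kummerRoot W p hdiv N P with hQdef
  rw [kummerMapLevel_eq_kummerClass W p hdiv N P Q hQn]
  change oneCocycleClass _ (kummerCocycle W p N Q (smul_nsmul_of_nsmul_eq W p hQn)) ∈ _
  refine (oneCocycleClass_mem_resKer_iff (resGal (K := K) E) (primaryPointsMap W E p)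
    (primaryPointsMap_smul W E p) _).mpr ?_
  -- the `E`-rational points inside `E(Ē)` and the comparison `ι(P) = ι_E(bc P)`
  let ιE : (W.baseChange E).toAffine.Point →+ localPoints W E :=
    Affine.Point.map (W' := W) (IsScalarTower.toAlgHom K E (AlgebraicClosure E))
  have hιE : ∀ X : (W.baseChange E).toAffine.Point,
      Affine.Point.map (W' := W) (IsScalarTower.toAlgHom K E (AlgebraicClosure E)) X = ιE X :=
    fun _ => rfl
  have hjP : pointsMap W E (toGeomPoints W P) = ιE (Affine.Point.baseChange (W' := W) K E P) := by
    change Affine.Point.map (closureEmb (K := K) E)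
        (Affine.Point.baseChange (W' := W) K (AlgebraicClosure K) P) =
      Affine.Point.map _ (Affine.Point.baseChange (W' := W) K E P)
    rw [Affine.Point.map_baseChange, Affine.Point.map_baseChange]
  -- the `p`-power-torsion element `z := ι Q − ι_E R'` (`p^N z = −ι_E T₁`, `p^(b+N) z = 0`)
  have hz : p ^ (b + N) • (pointsMap W E Q - ιE R') = 0 := by
    rw [pow_add, mul_smul, smul_sub, ← map_nsmul (pointsMap W E), hQn, hjP, ← map_nsmul ιE, ← h1,
      map_add, sub_add_cancel_left, smul_neg, ← map_nsmul ιE, hT₁, map_zero, neg_zero]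
  refine ⟨⟨pointsMap W E Q - ιE R', (AddCommGroup.mem_primaryComponent).2 ⟨b + N, hz⟩⟩, fun τ => ?_⟩
  apply Subtype.ext
  change pointsMap W E (((kummerCocycle W p N Q (smul_nsmul_of_nsmul_eq W p hQn)).1
      (resGal (K := K) E τ) : geomPrimaryTorsion W p) : geomPoints W) =
    τ • (pointsMap W E Q - ιE R') - (pointsMap W E Q - ιE R')
  rw [coe_kummerCocycle_apply, map_sub, pointsMap_smul, smul_sub,
    smul_eq_of_map_eq W E τ R' (hιE R')]
  abel

/-! ### §2 Algebra: exact `p`-divisibility level MODULO TORSION in a group with `λ : G → ℤ_p` -/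

/-- **Exact mod-torsion level forces the divisibility bound — no `p`-torsion hypothesis.** Let `G`
carry `λ : G →+ ℤ_p` vanishing exactly on torsion; let `X₀ ∈ G` have exact level `n` MODULO TORSION:
`p^n • Q = X₀ + T₀` for some torsion `T₀`, and no `Q'`, torsion `T'` with `p^(n+1) • Q' = X₀ + T'`.
If `k • X₀ = p^N • R + T` with `T` torsion and `k ≠ 0`, then `N ≤ n + v_p(k)`. (Else `k = p^v k₁`,
`p ∤ k₁`, `N = n + v + d + 1`; applying `λ` and cancelling `p^(n+v)` in the domain `ℤ_p`:
`k₁ λQ = p^(d+1) λR`; Bezout `a p + b k₁ = 1` gives `λQ = p · λ(a•Q + b p^d • R)`, so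
`Q ≡ p • (a•Q + b p^d • R)` modulo torsion and `X₀` would have mod-torsion level `≥ n + 1`.) The
torsion-free original is b2b's `le_add_padicValInt_of_zsmul_eq_nsmul_add`.
[cite: SilvermanAEC2009, Prop. VII.6.3] [cite: GreenbergLNM1716, §2 (pp. 62–63)] -/
theorem le_add_padicValInt_of_zsmul_eq_nsmul_add_modTorsion {G : Type*} [AddCommGroup G] (p : ℕ)
    [Fact p.Prime] (lam : G →+ ℤ_[p]) (hlam : ∀ X, lam X = 0 ↔ IsOfFinAddOrder X)
    {n : ℕ} {X₀ Q T₀ : G} (hT₀ : IsOfFinAddOrder T₀) (hQ : p ^ n • Q = X₀ + T₀)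
    (hndiv : ∀ Q' T' : G, IsOfFinAddOrder T' → p ^ (n + 1) • Q' ≠ X₀ + T')
    {k : ℤ} (hk : k ≠ 0) {N : ℕ} {R T : G} (hT : IsOfFinAddOrder T)
    (h : k • X₀ = p ^ N • R + T) :
    N ≤ n + padicValInt p k := by
  have hp : p.Prime := Fact.out
  have hp0 : (p : ℤ_[p]) ≠ 0 := by exact_mod_cast hp.ne_zero
  by_contra hlt
  rw [not_le] at hlt
  set v := padicValInt p k with hv
  -- `k = p^v k₁`, `p ∤ k₁`
  obtain ⟨k₁, hk₁⟩ : (p : ℤ) ^ v ∣ k := padicValInt_dvd k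
  have hk₁p : ¬ (p : ℤ) ∣ k₁ := by
    intro hdvd
    have h1 : (p : ℤ) ^ (v + 1) ∣ k := by rw [hk₁, pow_succ]; exact mul_dvd_mul_left _ hdvd
    rcases (padicValInt_dvd_iff (v + 1) k).mp h1 with h0 | hle
    · exact hk h0
    · omega
  obtain ⟨d, hd⟩ : ∃ d, N = n + v + (d + 1) := ⟨N - (n + v) - 1, by omega⟩
  -- apply `λ`: `λ X₀ = p^n λ Q`, `k λ X₀ = p^N λ R`
  have hlamX₀ : lam X₀ = (p : ℤ_[p]) ^ n * lam Q := by
    have h2 := congrArg lam hQ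
    rw [map_nsmul, map_add, (hlam T₀).mpr hT₀, add_zero, nsmul_eq_mul, Nat.cast_pow] at h2
    exact h2.symm
  have hlamQ : (k₁ : ℤ_[p]) * lam Q = (p : ℤ_[p]) ^ (d + 1) * lam R := by
    have h1 := congrArg lam h
    rw [map_zsmul, map_add, map_nsmul, (hlam T).mpr hT, add_zero, hk₁, hd, zsmul_eq_mul,
      nsmul_eq_mul, hlamX₀] at h1
    push_cast at h1
    have h2 : (p : ℤ_[p]) ^ (n + v) * ((k₁ : ℤ_[p]) * lam Q) =
        (p : ℤ_[p]) ^ (n + v) * ((p : ℤ_[p]) ^ (d + 1) * lam R) := by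
      rw [pow_add, pow_add, pow_add] at *
      linear_combination h1
    exact mul_left_cancel₀ (pow_ne_zero _ hp0) h2
  -- Bezout `a p + b k₁ = 1`: `λ Q = p · λ(a • Q + (b p^d) • R)`
  have hcop : IsCoprime (p : ℤ) k₁ :=
    (Irreducible.coprime_iff_not_dvd (Nat.prime_iff_prime_int.mp hp).irreducible).mpr hk₁p
  obtain ⟨a, b, hab⟩ := hcop
  set Y₀ : G := a • Q + (b * (p : ℤ) ^ d) • R with hY₀
  have hlamY₀ : lam Q = (p : ℤ_[p]) * lam Y₀ := by
    have hab' : (a : ℤ_[p]) * p + b * k₁ = 1 := by exact_mod_cast hab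
    rw [hY₀, map_add, map_zsmul, map_zsmul, zsmul_eq_mul, zsmul_eq_mul]
    push_cast
    linear_combination (-(lam Q)) * hab' + (b : ℤ_[p]) * hlamQ
  -- `Q − p • Y₀` is torsion, so `X₀` has mod-torsion level `≥ n + 1`: contradiction
  have hT'' : IsOfFinAddOrder (Q - p • Y₀) := by
    rw [← hlam, map_sub, map_nsmul, nsmul_eq_mul, hlamY₀, sub_self]
  have hTtors : IsOfFinAddOrder (T₀ - p ^ n • (Q - p • Y₀)) := by
    rw [← hlam, map_sub, map_nsmul, (hlam T₀).mpr hT₀, (hlam _).mpr hT'', smul_zero, sub_zero]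
  apply hndiv Y₀ (T₀ - p ^ n • (Q - p • Y₀)) hTtors
  rw [eq_sub_of_add_eq hQ.symm, smul_sub, pow_succ, mul_smul]
  abel

/-- **Exact mod-torsion levels exist.** In an additive group with `λ : G → ℤ_p` vanishing exactly on
torsion, a point `X` of infinite order has an exact level modulo torsion:
`∃ n, (∃ Q T, T torsion ∧ pⁿ • Q = X + T) ∧ ∀ Q T, T torsion → pⁿ⁺¹ • Q ≠ X + T` (levels are
bounded by `v_p(λ X)`; `Nat.findGreatest`). For `G = E(ℚ_p) ⊇` finite-index `ℤ_p` (AEC VII.6.3) this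
is the valuation of the free coordinate of `X`. [cite: SilvermanAEC2009, Prop. VII.6.3] -/
theorem exists_modTorsion_level {G : Type*} [AddCommGroup G] (p : ℕ) [Fact p.Prime]
    (lam : G →+ ℤ_[p]) (hlam : ∀ X, lam X = 0 ↔ IsOfFinAddOrder X) {X : G}
    (hX : ¬ IsOfFinAddOrder X) :
    ∃ n : ℕ, (∃ Q T : G, IsOfFinAddOrder T ∧ p ^ n • Q = X + T) ∧
      ∀ Q T : G, IsOfFinAddOrder T → p ^ (n + 1) • Q ≠ X + T := by
  have hX0 : lam X ≠ 0 := fun h => hX ((hlam X).mp h)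
  have hbd : ∀ (m : ℕ) (Q T : G), IsOfFinAddOrder T → p ^ m • Q = X + T →
      m ≤ (lam X).valuation := by
    intro m Q T hT hQ
    have h1 : lam X = (p : ℤ_[p]) ^ m * lam Q := by
      have h2 := congrArg lam hQ
      rw [map_nsmul, map_add, (hlam T).mpr hT, add_zero, nsmul_eq_mul, Nat.cast_pow] at h2
      exact h2.symm
    have hQ0 : lam Q ≠ 0 := by
      intro h0; rw [h0, mul_zero] at h1; exact hX0 h1
    rw [h1, PadicInt.valuation_p_pow_mul m _ hQ0]
    exact Nat.le_add_right m _
  refine ⟨Nat.findGreatest (fun m => ∃ Q T : G, IsOfFinAddOrder T ∧ p ^ m • Q = X + T)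
      (lam X).valuation,
    Nat.findGreatest_spec (P := fun m => ∃ Q T : G, IsOfFinAddOrder T ∧ p ^ m • Q = X + T)
      (Nat.zero_le _) ⟨X, 0, isOfFinAddOrder_iff_nsmul_eq_zero.mpr ⟨1, Nat.one_pos, smul_zero _⟩,
        by rw [pow_zero, one_smul, add_zero]⟩,
    fun Q T hT hQ => ?_⟩
  have hle := hbd _ Q T hT hQ
  exact Nat.findGreatest_is_greatest
    (P := fun m => ∃ Q T : G, IsOfFinAddOrder T ∧ p ^ m • Q = X + T) (Nat.lt_succ_self _) hle
    ⟨Q, T, hT, hQ⟩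

/-! ### §3 The index theorem over a number field, local torsion allowed -/

/-- **`#(Sel_{p^∞}(E/K) ∩ Sel_str at E) = p^ñ · #Ш(E/K)[p^∞]` in rank one, `ñ` the level MODULO
TORSION — general form, NO `p`-torsion hypothesis.** For an elliptic curve `E` over a number field
`K`, a prime `p`, a perfect `K`-field `E` with `λ : E(E) → ℤ_p` (kernel = torsion, `p^b ℤ_p ⊆ im λ`),
IF every `Sel_{p^∞}` class satisfies the local Kummer condition at `E` (`hloc`) and
`E(K) = ℤ·P + E(K)_tors` with `P` of infinite order whose image in `E(E)` has exact level `ñ` modulo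
torsion (`hdivP`, `hndiv`), THEN `Nat.card (Sel_{p^∞} ⊓ strict) = p^ñ · Nat.card Ш(E/K)[p^∞]`
(`Nat.card = 0` on both sides when `Ш[p^∞]` is infinite). Proof = b2b's
`card_strictSelmer_eq_pow_mul_card_sha_of_hom` verbatim (`S₀ ↠ Ш[p^∞]`, kernel = the STRICT Kummer
classes `{κ_ñ(a·P)} ≅ ℤ/p^ñ`) with §1 for «`κ_ñ(a·P)` is strict» and §2 for «a strict `κ_N(k·P)` has
level `ñ`». Greenberg LNM 1716 §2 pp. 62–63; Kurihara–Pollack 2007 §1.5.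
[cite: GreenbergLNM1716, §2 (pp. 62–63)] [cite: KuriharaPollack2007, §1.5 (p. 361)]
[cite: SilvermanAEC2009, Prop. VII.6.3] -/
theorem card_strictSelmer_eq_pow_mul_card_sha_modTorsion {K : Type u} [Field K] [NumberField K]
    (W : WeierstrassCurve K) [W.IsElliptic] (p : ℕ) [Fact p.Prime]
    (E : Type u) [Field E] [Algebra K E] [PerfectField E]
    (lam : (W.baseChange E).toAffine.Point →+ ℤ_[p]) {b : ℕ}
    (hlam : ∀ X, lam X = 0 ↔ IsOfFinAddOrder X)
    (hlamb : ∀ z : ℤ_[p], ∃ Y, lam Y = (p : ℤ_[p]) ^ b * z)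
    (hloc : W.selmerGroupPInfty p ≤ selmerLocalKerPrimary W E p)
    {P : W.toAffine.Point} {n : ℕ} (hP : ¬ IsOfFinAddOrder P)
    (hgen : ∀ R : W.toAffine.Point, ∃ (k : ℤ) (T : W.toAffine.Point),
      IsOfFinAddOrder T ∧ R = k • P + T)
    (hdivP : ∃ Q T : (W.baseChange E).toAffine.Point, IsOfFinAddOrder T ∧
      p ^ n • Q = Affine.Point.baseChange (W' := W) K E P + T)
    (hndiv : ∀ Q T : (W.baseChange E).toAffine.Point, IsOfFinAddOrder T →
      p ^ (n + 1) • Q ≠ Affine.Point.baseChange (W' := W) K E P + T) :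
    Nat.card ↥(W.selmerGroupPInfty p ⊓ selmerLocalKerPrimaryTorsion W E p) =
      p ^ n * Nat.card (AddCommGroup.primaryComponent W.sha p) := by
  have hpP : p.Prime := Fact.out
  have hdiv : W.zsmul_geomPoints_surjective := W.zsmul_geomPoints_surjective_holds
  let bc : W.toAffine.Point →+ (W.baseChange E).toAffine.Point :=
    Affine.Point.baseChange (W' := W) K E
  have hbc : ∀ X, Affine.Point.baseChange (W' := W) K E X = bc X := fun _ => rfl
  have hinj : Function.Injective bc := Affine.Point.map_injective (W' := W) (Algebra.ofId K E)
  obtain ⟨Q, T₀, hT₀, hQ⟩ := hdivP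
  rw [hbc] at hQ
  have hndiv' : ∀ Q' T' : (W.baseChange E).toAffine.Point, IsOfFinAddOrder T' →
      p ^ (n + 1) • Q' ≠ bc P + T' := fun Q' T' hT' => by rw [← hbc]; exact hndiv Q' T' hT'
  have hu0 : lam (bc P) ≠ 0 := by
    intro h0
    apply hP
    obtain ⟨m, hm, hmP⟩ := isOfFinAddOrder_iff_nsmul_eq_zero.mp ((hlam _).mp h0)
    refine isOfFinAddOrder_iff_nsmul_eq_zero.mpr ⟨m, hm, hinj ?_⟩
    rw [map_nsmul, map_zero]
    exact hmP
  set S₀ := W.selmerGroupPInfty p ⊓ selmerLocalKerPrimaryTorsion W E p with hS₀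
  set πS : S₀ →+ W.galH1 := (primaryH1ToH1 W p).comp S₀.subtype with hπS
  -- (i) the image of `S₀` in `H¹(K, E)` is ALL of `Ш[p^∞]` (core of `StrictSelmerDominatesSha`)
  have hrange : πS.range = (AddCommGroup.primaryComponent W.sha p).map W.sha.subtype := by
    rw [← map_primaryH1ToH1_selmerGroupPInfty W p hdiv]
    ext x
    constructor
    · rintro ⟨c, rfl⟩
      exact ⟨c, c.2.1, rfl⟩
    · rintro ⟨s, hs, rfl⟩
      obtain ⟨m, a, hstr⟩ := exists_sub_kummerMapLevel_mem_selmerLocalKerPrimaryTorsion W p hdiv E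
        lam hlam hlamb P hu0 s (hloc hs)
      have hker : kummerMapLevel W p hdiv m (a • P) ∈ W.selmerGroupPInfty p :=
        ker_primaryH1ToH1_le_selmerGroupPInfty W p (primaryH1ToH1_kummerMapLevel W p hdiv m (a • P))
      refine ⟨⟨s - kummerMapLevel W p hdiv m (a • P), (W.selmerGroupPInfty p).sub_mem hs hker,
        hstr⟩, ?_⟩
      change primaryH1ToH1 W p (s - kummerMapLevel W p hdiv m (a • P)) = primaryH1ToH1 W p s
      rw [map_sub, primaryH1ToH1_kummerMapLevel, sub_zero]
  have hcardSha : Nat.card (AddCommGroup.primaryComponent W.sha p) = Nat.card πS.range := by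
    rw [hrange]
    exact Nat.card_congr ((AddCommGroup.primaryComponent W.sha p).equivMapOfInjective
      W.sha.subtype Subtype.val_injective).toEquiv
  -- (ii) the kernel of `πS` = the STRICT Kummer classes = `{κ_n(a • P)}` ≅ `ℤ/p^n`
  set φ : ℤ →+ galH1Primary W p := (kummerMapLevel W p hdiv n).comp (zmultiplesHom _ P) with hφdef
  have hφ : ∀ a : ℤ, φ a = kummerMapLevel W p hdiv n (a • P) := fun a => by
    rw [hφdef, AddMonoidHom.comp_apply, zmultiplesHom_apply]
  have hkerφ : φ.ker = AddSubgroup.zmultiples ((p ^ n : ℕ) : ℤ) := by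
    ext a
    rw [AddMonoidHom.mem_ker, hφ, AddSubgroup.mem_zmultiples_iff]
    constructor
    · intro h0
      obtain ⟨m, P₀, hP₀⟩ := exists_of_kummerMapLevel_eq_zero W p hdiv n (a • P) h0
      obtain ⟨k, T, hT, rfl⟩ := hgen P₀
      -- `(p^m a − p^(n+m) k) • P = p^(n+m) • T` is torsion, so the scalar vanishes
      have hc : ((p ^ m : ℕ) * a - (p ^ (n + m) : ℕ) * k : ℤ) • P = p ^ (n + m) • T := by
        rw [sub_smul, mul_smul, mul_smul, natCast_zsmul, natCast_zsmul, hP₀, smul_add]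
        abel
      have hc0 := zsmul_eq_zero_of_isOfFinAddOrder hP (hc ▸ hT.nsmul)
      refine ⟨k, ?_⟩
      have h1 : ((p ^ m : ℕ) : ℤ) * a = ((p ^ m : ℕ) : ℤ) * ((p ^ n : ℕ) * k) := by
        push_cast at hc0 ⊢
        linear_combination hc0
      have hpm : ((p ^ m : ℕ) : ℤ) ≠ 0 := by exact_mod_cast pow_ne_zero m hpP.ne_zero
      rw [mul_left_cancel₀ hpm h1, smul_eq_mul, mul_comm]
    · rintro ⟨k, rfl⟩
      rw [smul_eq_mul, mul_smul, natCast_zsmul, smul_comm, kummerMapLevel_nsmul_self]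
  have hrangeφ : φ.range = (πS.ker).map S₀.subtype := by
    ext x
    constructor
    · rintro ⟨a, rfl⟩
      rw [hφ]
      have hker : primaryH1ToH1 W p (kummerMapLevel W p hdiv n (a • P)) = 0 :=
        primaryH1ToH1_kummerMapLevel W p hdiv n (a • P)
      have hSel : kummerMapLevel W p hdiv n (a • P) ∈ W.selmerGroupPInfty p :=
        ker_primaryH1ToH1_le_selmerGroupPInfty W p hker
      -- strictness MODULO TORSION: `bc(a • P) + a • T₀ = p^n • (a • Q)` (§1)
      have haT₀ : IsOfFinAddOrder (a • T₀) := by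
        rw [← hlam, map_zsmul, (hlam T₀).mpr hT₀, smul_zero]
      have hstr : kummerMapLevel W p hdiv n (a • P) ∈ selmerLocalKerPrimaryTorsion W E p :=
        kummerMapLevel_mem_selmerLocalKerPrimaryTorsion_of_add_torsion_eq_nsmul W p hdiv E n (a • P)
          (a • Q) (a • T₀) haT₀ (by rw [hbc, map_zsmul, ← smul_add, ← hQ, smul_comm])
      exact ⟨⟨kummerMapLevel W p hdiv n (a • P), hSel, hstr⟩, hker, rfl⟩
    · rintro ⟨c, hc, rfl⟩
      have hc0 : primaryH1ToH1 W p c = 0 := hc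
      have hcker : (c : galH1Primary W p) ∈ (kummerMapPInfty W p hdiv).range := by
        rw [range_kummerMapPInfty W p hdiv]
        exact hc0
      obtain ⟨t, ht⟩ := hcker
      obtain ⟨R', N, rfl⟩ := exists_eq_tmul_prufGen W p t
      rw [kummerMapPInfty_tmul_prufGen] at ht
      obtain ⟨k, T, hT, rfl⟩ := hgen R'
      rw [map_add, kummerMapLevel_eq_zero_of_isOfFinAddOrder W p hdiv N hT, add_zero] at ht
      -- the class is strict: `res κ_N(k • P) = 0`
      have hres : resH1Hom (resGal (K := K) E) (primaryPointsMap W E p)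
          (primaryPointsMap_smul W E p) (kummerMapLevel W p hdiv N (k • P)) = 0 := by
        have h2 : (c : galH1Primary W p) ∈ selmerLocalKerPrimaryTorsion W E p := c.2.2
        rw [← ht] at h2
        exact h2
      change (c : galH1Primary W p) ∈ φ.range
      rw [← ht]
      rcases eq_or_ne k 0 with rfl | hk
      · exact ⟨0, by rw [zero_smul, map_zero, map_zero]⟩
      obtain ⟨R, T', hT', hRT⟩ :=
        exists_eq_nsmul_add_of_res_kummerMapLevel_eq_zero W p hdiv E N (k • P) hres
      rw [hbc, map_zsmul] at hRT
      have hle : N ≤ n + padicValInt p k :=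
        le_add_padicValInt_of_zsmul_eq_nsmul_add_modTorsion p lam hlam hT₀ hQ hndiv' hk hT' hRT
      -- `p^(N-n) ∣ k`, so `κ_N(k • P)` has level `n`
      obtain ⟨k₂, hk₂⟩ : (p : ℤ) ^ (N - n) ∣ k :=
        (padicValInt_dvd_iff (N - n) k).mpr (Or.inr (by omega))
      rcases le_or_gt n N with hnN | hNn
      · refine ⟨k₂, ?_⟩
        rw [hφ, hk₂, mul_smul, ← Nat.cast_pow, natCast_zsmul]
        exact (kummerMapLevel_level W p hdiv n (N - n) N (by omega) (k₂ • P)).symm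
      · refine ⟨(p : ℤ) ^ (n - N) * k, ?_⟩
        rw [hφ, mul_smul, ← Nat.cast_pow, natCast_zsmul]
        exact kummerMapLevel_level W p hdiv N (n - N) n (by omega) (k • P)
  have hcardKer : Nat.card πS.ker = p ^ n := by
    have e1 : Nat.card πS.ker = Nat.card φ.range := by
      rw [hrangeφ]
      exact Nat.card_congr (πS.ker.equivMapOfInjective S₀.subtype Subtype.val_injective).toEquiv
    rw [e1, ← Nat.card_congr (QuotientAddGroup.quotientKerEquivRange φ).toEquiv, hkerφ,
      Nat.card_congr (Int.quotientZMultiplesNatEquivZMod (p ^ n)).toEquiv, Nat.card_zmod]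
  -- (iii) counting
  rw [AddSubgroup.card_eq_card_quotient_mul_card_addSubgroup πS.ker,
    Nat.card_congr (QuotientAddGroup.quotientKerEquivRange πS).toEquiv, ← hcardSha, hcardKer,
    mul_comm]

end Summit.BirchSwinnertonDyer.Rank1Residual.X12.O11

end
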